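import Summits.CriticalPhenomena.CardyFormulaZ2.Theses.CardyIKTransport
import Literature.Probability.RandomPlanarGeometry.ConformalRectangleProofs
import Literature.Probability.RandomPlanarGeometry.CardyFunctionIncBeta
import Literature.Probability.RandomPlanarGeometry.DiscRectangles

/-!
# `CornerLineDescent` (route `CardyIKTransport`, stmt-CriticalPhenomena-10964): model-blind transport
# of Cardy limits is false — symmetry and self-duality of the target family do not help

Negative-side support for the crux `CornerLineDescent` (cdisprove unit, cycle 1).  The crux is
`CardyIK → CrudeBondCardy`: Cardy's formula for the isotropic Izergin–Korepin gauge in every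
conformal rectangle implies Cardy's formula for the crude bond-`ℤ²` crossing event in every conformal
rectangle.  Its intended mechanism descends the self-dual, `D₄`-symmetric corner-fugacity line and
closes "by AnchorByRigidity-type rigidity, both ends being `D₄`-symmetric".  This file records, as
kernel-checked negatives, that NOTHING of the kind follows from the shapes alone:

* `cornerLineDescent_not_blind_transport` — "Cardy for one family of crossing probabilities ⇒ Cardy
  for another" is false (`P :=` the Cardy value of the conformal modulus, constant in `δ`; `Q := 0`);
* `cornerLineDescent_not_transport_under` — for EVERY property `Symm` of crossing families enjoyed by
  the constant family `½` (quarter-turn invariance = hypothesis (a) of `AnchorByRigidity`, full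
  dihedral and translation covariance, exact self-duality `Q R δ + Q R† δ = 1`, values in `[0,1]`, …)
  the implication "Cardy for `P` ∧ `Symm Q` ⇒ Cardy for `Q`" is false; instance
  `cornerLineDescent_not_quarterTurn_selfDual_transport` spells out (a) + self-duality + `[0,1]`-values.

Witness: the disc rectangle `(𝔻; 1, e^{iπ/3}, −1, −e^{iπ/3})` with its explicit Cayley uniformizing
datum (`Literature …DiscRectangles`), modulus `η = 1/4`, where `0 < F(1/4) < F(1/2) = 1/2`.
Moral for provers: the rigidity step only removes a linear-map ambiguity AFTER a transport along the
corner line (`t ∈ [0, √3/2]`) has been established; the transport is the entire content of the crux.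
-/

noncomputable section

open Filter Topology Set Complex
open Literature.Probability.RandomPlanarGeometry

namespace Summit.CriticalPhenomena.CardyFormulaZ2.Theorems.CornerLineDescent.Negative

/-- There is a family of "crossing probabilities" with Cardy limits in every conformal rectangle:
the constant-in-`δ` family "Cardy value of the conformal modulus" (uniformizing data exist by
Riemann mapping + Carathéodory, `MarkedDomain.exists_isUniformizing_holds`, and all data of one
rectangle have the same cross-ratio, `ConformalRectangle.crossRatio_eq_of_isUniformizing_holds`).
[folklore] -/
theorem exists_family_hasCrossingLimit_cardy :
    ∃ P : ConformalRectangle → ℝ → ℝ,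
      ∀ R : ConformalRectangle, R.HasCrossingLimit (P R) cardyFunction := by
  refine ⟨fun R _ ↦ cardyFunction (crossRatio (Classical.choose (Classical.choose_spec
    (MarkedDomain.exists_isUniformizing_holds R)))), fun R φ x hφx ↦ ?_⟩
  have h := ConformalRectangle.crossRatio_eq_of_isUniformizing_holds hφx
    (Classical.choose_spec (Classical.choose_spec (MarkedDomain.exists_isUniformizing_holds R)))
  rw [h]
  exact tendsto_const_nhds

/-- `F(1/2) = 1/2`, from the duality symmetry `F(1-η) = 1 - F(η)` at `η = 1/2`
(Cardy 1992, discussion after eq. (11)). [folklore] -/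
theorem cardyFunction_one_half : cardyFunction (1 / 2) = 1 / 2 := by
  have h := cardyFunction_one_sub_holds (η := 1 / 2) ⟨by norm_num, by norm_num⟩
  norm_num at h
  linarith

/-- `0 < F(1/4) < 1/2` (`F` strictly increasing on `[0,1]`, `F 0 = 0`, `F(1/2) = 1/2`). [folklore] -/
theorem cardyFunction_quarter_bounds :
    0 < cardyFunction (1 / 4) ∧ cardyFunction (1 / 4) < 1 / 2 := by
  have hmono := strictMonoOn_cardyFunction_holds
  have h0 : (0 : ℝ) ∈ Icc (0 : ℝ) 1 := ⟨le_rfl, zero_le_one⟩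
  have hq : (1 / 4 : ℝ) ∈ Icc (0 : ℝ) 1 := ⟨by norm_num, by norm_num⟩
  have hh : (1 / 2 : ℝ) ∈ Icc (0 : ℝ) 1 := ⟨by norm_num, by norm_num⟩
  constructor
  · have := hmono h0 hq (by norm_num)
    rwa [cardyFunction_zero] at this
  · have := hmono hq hh (by norm_num)
    rwa [cardyFunction_one_half] at this

/-- An explicit conformal rectangle of modulus `1/4`: the unit disc marked at
`1, e^{iπ/3}, -1, -e^{iπ/3}` (`ConformalRectangle.symmDisc 0 (1/6)`), with its Cayley uniformizing
datum (`ConformalRectangle.exists_isUniformizing_of_symm`: cross-ratio `(1 - cos (π/3))/2`). [folklore] -/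
theorem exists_conformalRectangle_crossRatio_quarter :
    ∃ (R : ConformalRectangle) (φ : ConformalEquiv UpperHalfPlane.upperHalfPlaneSet R.carrier)
      (x : Fin 4 → ℝ), R.IsUniformizing φ x ∧ crossRatio x = 1 / 4 := by
  have hs : (1 / 6 : ℝ) ∈ Ioo (0 : ℝ) (1 / 2) := ⟨by norm_num, by norm_num⟩
  set R : ConformalRectangle := ConformalRectangle.symmDisc 0 (1 / 6) hs with hR
  set ζ : ℂ := exp (((0 : ℝ) : ℂ) * I) with hζ
  set u : ℂ := exp (((2 * Real.pi * (1 / 6 : ℝ) : ℝ) : ℂ) * I) with hu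
  have hζ_norm : ‖ζ‖ = 1 := by rw [hζ]; exact norm_exp_ofReal_mul_I _
  have hu_norm : ‖u‖ = 1 := by rw [hu]; exact norm_exp_ofReal_mul_I _
  have harg : 2 * Real.pi * (1 / 6 : ℝ) = Real.pi / 3 := by ring
  have hu_re : u.re = 1 / 2 := by
    rw [hu, exp_ofReal_mul_I_re, harg, Real.cos_pi_div_three]
  have hu_im : u.im ≠ 0 := by
    rw [hu, exp_ofReal_mul_I_im, harg, Real.sin_pi_div_three]
    positivity
  have hp0 : R.pt 0 = ζ := ConformalRectangle.symmDisc_pt_zero 0 (1 / 6) hs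
  have hp1 : R.pt 1 = u * ζ := ConformalRectangle.symmDisc_pt_one 0 (1 / 6) hs
  have hp2 : R.pt 2 = -ζ := ConformalRectangle.symmDisc_pt_two 0 (1 / 6) hs
  have hp3 : R.pt 3 = -(u * ζ) := ConformalRectangle.symmDisc_pt_three 0 (1 / 6) hs
  obtain ⟨φ, x, hUx, hcrx⟩ := R.exists_isUniformizing_of_symm (ConformalEquiv.refl (Metric.ball 0 1))
    (Ψ := id) continuousOn_id (fun _ _ ↦ rfl) hζ_norm hu_norm hu_im
    (by rw [hp0]; rfl) (by rw [hp1]; rfl) (by rw [hp2]; rfl) (by rw [hp3]; rfl)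
  refine ⟨R, φ, x, hUx, ?_⟩
  rw [hcrx, hu_re]
  norm_num

/-- A constant family `c` has Cardy limits in every conformal rectangle only if `c = F(1/4)`
(uniqueness of limits along the proper filter `𝓝[>] 0` on the rectangle of modulus `1/4`). [folklore] -/
theorem const_hasCrossingLimit_imp {c : ℝ}
    (h : ∀ R : ConformalRectangle, R.HasCrossingLimit (fun _ ↦ c) cardyFunction) :
    c = cardyFunction (1 / 4) := by
  obtain ⟨R, φ, x, hUx, hcr⟩ := exists_conformalRectangle_crossRatio_quarter
  have h1 := h R φ x hUx
  rw [hcr] at h1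
  exact tendsto_nhds_unique tendsto_const_nhds h1

/-- MODEL-BLIND TRANSPORT IS FALSE: Cardy's formula for one family of crossing probabilities does
not imply it for another (`P :=` Cardy value of the modulus, `Q := 0`).  Any proof of
`CornerLineDescent` must use the lattice content of the IK gauge and of bond-`ℤ²`. [folklore] -/
theorem cornerLineDescent_not_blind_transport :
    ¬ ∀ P Q : ConformalRectangle → ℝ → ℝ,
      (∀ R : ConformalRectangle, R.HasCrossingLimit (P R) cardyFunction) →
        ∀ R : ConformalRectangle, R.HasCrossingLimit (Q R) cardyFunction := by
  intro H
  obtain ⟨P, hP⟩ := exists_family_hasCrossingLimit_cardy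
  have hQ := H P (fun _ _ ↦ (0 : ℝ)) hP
  have h0 := const_hasCrossingLimit_imp hQ
  linarith [cardyFunction_quarter_bounds.1]

/-- SYMMETRY / SELF-DUALITY OF THE TARGET DO NOT HELP WITHOUT A TRANSPORT: for every property `Symm`
of crossing families that the constant family `½` enjoys, "Cardy for `P` and `Symm Q` ⇒ Cardy for
`Q`" fails (`Q := ½` has limit `½ ≠ F(1/4)` on the rectangle of modulus `1/4`). [folklore] -/
theorem cornerLineDescent_not_transport_under (Symm : (ConformalRectangle → ℝ → ℝ) → Prop)
    (hhalf : Symm (fun _ _ ↦ 1 / 2)) :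
    ¬ ∀ P Q : ConformalRectangle → ℝ → ℝ, Symm Q →
      (∀ R : ConformalRectangle, R.HasCrossingLimit (P R) cardyFunction) →
        ∀ R : ConformalRectangle, R.HasCrossingLimit (Q R) cardyFunction := by
  intro H
  obtain ⟨P, hP⟩ := exists_family_hasCrossingLimit_cardy
  have hQ := H P (fun _ _ ↦ (1 / 2 : ℝ)) hhalf hP
  have h0 := const_hasCrossingLimit_imp hQ
  linarith [cardyFunction_quarter_bounds.2]

/-- The instance in the route's own vocabulary: quarter-turn invariance of the limits (hypothesis (a)
of `AnchorByRigidity`, the shape of `IKQuarterTurn`), exact self-duality in the degenerate rendering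
`Q R δ + Q R δ = 1` available to a constant family, and values in `[0,1]`, together with Cardy's
formula for some other family `P`, do NOT give Cardy's formula for `Q`.  Hypothesis (b) of
`AnchorByRigidity` — linear conjugacy to a family with Cardy limits, i.e. a TRANSPORT — is the
load-bearing input, and the descent `CornerLineDescent` needs its own analogue of it. [folklore] -/
theorem cornerLineDescent_not_quarterTurn_selfDual_transport :
    ¬ ∀ P Q : ConformalRectangle → ℝ → ℝ,
      ((∀ (R : ConformalRectangle) (L : ℝ),
          Tendsto (Q (R.map (Homeomorph.mulLeft₀ Complex.I Complex.I_ne_zero))) (𝓝[>] 0) (𝓝 L) ↔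
            Tendsto (Q R) (𝓝[>] 0) (𝓝 L)) ∧
        (∀ (R : ConformalRectangle) (δ : ℝ), Q R δ + Q R δ = 1) ∧
        (∀ (R : ConformalRectangle) (δ : ℝ), Q R δ ∈ Icc (0 : ℝ) 1)) →
      (∀ R : ConformalRectangle, R.HasCrossingLimit (P R) cardyFunction) →
        ∀ R : ConformalRectangle, R.HasCrossingLimit (Q R) cardyFunction := by
  refine cornerLineDescent_not_transport_under
    (fun Q ↦ (∀ (R : ConformalRectangle) (L : ℝ),
        Tendsto (Q (R.map (Homeomorph.mulLeft₀ Complex.I Complex.I_ne_zero))) (𝓝[>] 0) (𝓝 L) ↔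
          Tendsto (Q R) (𝓝[>] 0) (𝓝 L)) ∧
      (∀ (R : ConformalRectangle) (δ : ℝ), Q R δ + Q R δ = 1) ∧
      (∀ (R : ConformalRectangle) (δ : ℝ), Q R δ ∈ Icc (0 : ℝ) 1)) ⟨?_, ?_, ?_⟩
  · intro R L; exact Iff.rfl
  · intro R δ; norm_num
  · intro R δ; norm_num

end Summit.CriticalPhenomena.CardyFormulaZ2.Theorems.CornerLineDescent.Negative
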